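import Summits.AtomisticToContinuum.BoseEinsteinCondensation.Theses.BECConjugateDomination
import HarnessLib

/-!
# (α'_phys) part 3/4: the `ε`-bookkeeping of the cut-off argument (real and `ℝ≥0∞` arithmetic only)
# — line `third-law-current-floor`, crux `HardCoreExtension` (stmt-AtomisticToContinuum-11786), lead c1

From `E·μ ≤ q`, `1 ≤ μ + mK + mO`, `q ≤ (1+θ)Em + (1+θ⁻¹)(C/ℓ²)mO`, `m·mK ≤ E`, `mI ≤ mK`, `mO ≤ Cs·mI + Csℓ²·Kl`, `Kl ≤ ε₁`
and the parameter choices (`θ(E+1)6 ≤ ε`, `ε₁` small, `m` large) conclude `E ≤ Em + ε`; then the same in `ℝ≥0∞`. [folklore]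
-/

noncomputable section

namespace Summit.AtomisticToContinuum.BoseEinsteinCondensation.Cruxes.HardCoreExtension.ThirdLawCurrentFloor

open MeasureTheory Filter
open scoped ENNReal NNReal BigOperators Topology
open Literature.MathematicalPhysics.QuantumManyBody.BoseGas

namespace AlphaPhys

variable {N : ℕ} {L : ℝ}

/-! ### Real bookkeeping (small lemmas with few hypotheses each, to keep `nlinarith` cheap) -/

/-- `E·mK ≤ ε/6` from `m·mK ≤ E` and `(E²+1)·6 ≤ ε m`. [folklore] -/
theorem bk_core {E mK m ε : ℝ} (hE : 0 ≤ E) (hm : 0 < m) (hcore : m * mK ≤ E)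
    (hm1 : (E ^ 2 + 1) * 6 ≤ ε * m) : E * mK ≤ ε / 6 := by
  rw [le_div_iff₀ (by norm_num : (0:ℝ) < 6)]
  have h1 : E * mK * m ≤ E ^ 2 := by nlinarith [mul_le_mul_of_nonneg_left hcore hE]
  by_contra hcon
  push Not at hcon
  have h2 : ε * m < E * mK * 6 * m := by nlinarith
  nlinarith

/-- `E·mO ≤ ε/3` from the shell bound in product form. [folklore] -/
theorem bk_shellE {E mO Cs ℓ a ε₁ m ε : ℝ} (hE : 0 ≤ E) (hm : 0 < m) (hCs : 0 ≤ Cs) (hℓ : 0 < ℓ)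
    (hℓa : ℓ ≤ a) (hε₁ : 0 ≤ ε₁)
    (hmO : mO * m ≤ Cs * E + Cs * ℓ ^ 2 * ε₁ * m)
    (hm1 : Cs * E ^ 2 * 6 ≤ ε * m) (hε₁a : ε₁ * (Cs + 1) * (E + 1) * a ^ 2 * 6 ≤ ε) :
    E * mO ≤ ε / 3 := by
  have hℓ2 : 0 < ℓ ^ 2 := by positivity
  have hℓ2a : ℓ ^ 2 ≤ a ^ 2 := pow_le_pow_left₀ hℓ.le hℓa 2
  have hA3 : E * Cs * ℓ ^ 2 * ε₁ * 6 ≤ ε := by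
    have h1' : E * Cs ≤ (E + 1) * (Cs + 1) := by nlinarith
    have h2' : E * Cs * ℓ ^ 2 ≤ (E + 1) * (Cs + 1) * a ^ 2 :=
      mul_le_mul h1' hℓ2a hℓ2.le (by positivity)
    have h3' := mul_le_mul_of_nonneg_right h2' hε₁
    nlinarith
  rw [le_div_iff₀ (by norm_num : (0:ℝ) < 3)]
  have hA1 : E * mO * m ≤ Cs * E ^ 2 + E * Cs * ℓ ^ 2 * ε₁ * m := by
    nlinarith [mul_le_mul_of_nonneg_left hmO hE]
  by_contra hcon
  push Not at hcon
  have : ε * m < E * mO * 3 * m := by nlinarith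
  nlinarith [mul_nonneg (mul_nonneg (mul_nonneg hE hCs) hℓ2.le) hε₁]

/-- `A·mO ≤ ε/3` (`A = (1+θ⁻¹)C/ℓ²`) from the shell bound in product form. [folklore] -/
theorem bk_shellA {E mO Cs C ℓ θ ε₁ m ε : ℝ} (hm : 0 < m) (hCs : 0 ≤ Cs) (hC : 0 ≤ C)
    (hℓ : 0 < ℓ) (hθ : 0 < θ) (hε₁ : 0 ≤ ε₁)
    (hmO : mO * m ≤ Cs * E + Cs * ℓ ^ 2 * ε₁ * m)
    (hm2 : (1 + θ) * C * Cs * (E + 1) * 6 ≤ ε * θ * ℓ ^ 2 * m)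
    (hε₁b : ε₁ * (C * Cs + 1) * (1 + θ) * 6 ≤ ε * θ) :
    (1 + θ⁻¹) * (C / ℓ ^ 2) * mO ≤ ε / 3 := by
  have hℓ2 : 0 < ℓ ^ 2 := by positivity
  have hid : (1 + θ⁻¹) * (C / ℓ ^ 2) * mO = ((1 + θ) * C * mO) / (θ * ℓ ^ 2) := by
    field_simp
    ring
  rw [hid, div_le_div_iff₀ (by positivity) (by norm_num : (0:ℝ) < 3)]
  -- goal: `(1+θ) C mO · 3 ≤ ε (θ ℓ²)`; multiply by `m`
  have hB1 : (1 + θ) * C * mO * m ≤ (1 + θ) * C * Cs * E + (1 + θ) * C * Cs * ℓ ^ 2 * ε₁ * m := by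
    have := mul_le_mul_of_nonneg_left hmO (by positivity : (0:ℝ) ≤ (1 + θ) * C)
    nlinarith
  have hB3 : (1 + θ) * C * Cs * ℓ ^ 2 * ε₁ * 6 ≤ ε * θ * ℓ ^ 2 := by
    have h' : ε₁ * (C * Cs) * (1 + θ) * 6 ≤ ε * θ := by nlinarith
    nlinarith [mul_le_mul_of_nonneg_right h' hℓ2.le]
  have hB4 : (1 + θ) * C * Cs * ℓ ^ 2 * ε₁ * 6 * m ≤ ε * θ * ℓ ^ 2 * m :=
    mul_le_mul_of_nonneg_right hB3 hm.le
  have hB5 : (1 + θ) * C * Cs * E * 6 ≤ ε * θ * ℓ ^ 2 * m := by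
    have hnn : 0 ≤ (1 + θ) * C * Cs * 6 := by positivity
    nlinarith
  by_contra hcon
  push Not at hcon
  have : ε * (θ * ℓ ^ 2) * m < (1 + θ) * C * mO * 3 * m := by nlinarith
  nlinarith

/-- The final `ε`-bookkeeping of the cut-off argument, in real numbers. [folklore] -/
theorem bookkeeping {E Em θ q μ mK mO mI Kl Cs C ℓ a m ε ε₁ : ℝ}
    (hE : 0 ≤ E) (hEmE : Em ≤ E) (hθ : 0 < θ) (hCs : 0 ≤ Cs) (hC : 0 ≤ C)
    (hℓ : 0 < ℓ) (hℓa : ℓ ≤ a) (hm : 0 < m) (hε₁ : 0 ≤ ε₁)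
    (h1 : E * μ ≤ q) (h2 : 1 ≤ μ + mK + mO)
    (h4 : q ≤ (1 + θ) * Em + (1 + θ⁻¹) * (C / ℓ ^ 2) * mO)
    (hcore : m * mK ≤ E) (hinner : mI ≤ mK) (hshell : mO ≤ Cs * mI + Cs * ℓ ^ 2 * Kl) (hKl : Kl ≤ ε₁)
    (hθε : θ * (E + 1) * 6 ≤ ε) (hε₁a : ε₁ * (Cs + 1) * (E + 1) * a ^ 2 * 6 ≤ ε)
    (hε₁b : ε₁ * (C * Cs + 1) * (1 + θ) * 6 ≤ ε * θ)
    (hm1 : (1 + Cs) * (E ^ 2 + 1) * 6 ≤ ε * m) (hm2 : (1 + θ) * C * Cs * (E + 1) * 6 ≤ ε * θ * ℓ ^ 2 * m) :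
    E ≤ Em + ε := by
  have hℓ2 : 0 < ℓ ^ 2 := by positivity
  -- structural: `E ≤ (1+θ) Em + A mO + E mK + E mO`
  have hst : E ≤ (1 + θ) * Em + (1 + θ⁻¹) * (C / ℓ ^ 2) * mO + E * mK + E * mO := by
    have : E * 1 ≤ E * (μ + mK + mO) := mul_le_mul_of_nonneg_left h2 hE
    linarith [mul_add E μ mK, mul_add E (μ + mK) mO]
  -- the shell bound in product form
  have hmIE : mI * m ≤ E := by nlinarith
  have hmO : mO * m ≤ Cs * E + Cs * ℓ ^ 2 * ε₁ * m := by
    have h' : mO ≤ Cs * mI + Cs * ℓ ^ 2 * ε₁ := by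
      nlinarith [mul_le_mul_of_nonneg_left hKl (mul_nonneg hCs hℓ2.le)]
    nlinarith [mul_le_mul_of_nonneg_left hmIE hCs, mul_le_mul_of_nonneg_right h' hm.le]
  have t1 : θ * Em ≤ ε / 6 := by
    rw [le_div_iff₀ (by norm_num : (0:ℝ) < 6)]; nlinarith
  have t2 : E * mK ≤ ε / 6 := bk_core hE hm hcore (by nlinarith [sq_nonneg E])
  have t34 : E * mO ≤ ε / 3 := bk_shellE hE hm hCs hℓ hℓa hε₁ hmO (by nlinarith [sq_nonneg E]) hε₁a
  have t56 : (1 + θ⁻¹) * (C / ℓ ^ 2) * mO ≤ ε / 3 := bk_shellA hm hCs hC hℓ hθ hε₁ hmO hm2 hε₁b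
  linarith

/-- The `ε`-bookkeeping in `ℝ≥0∞` (atomic variables): finiteness, passage to reals, `bookkeeping`, and back.
[folklore] -/
theorem bookkeeping_ennreal {B Em q μ mK mO mI Kl : ℝ≥0∞} {θ Cs C ℓ a ε ε₁ : ℝ} {m : ℕ}
    (hB : B ≠ ⊤) (hEmB : Em ≤ B) (hθ : 0 < θ) (hCs : 0 ≤ Cs) (hC : 0 ≤ C) (hℓ : 0 < ℓ) (hℓa : ℓ ≤ a)
    (hm : 0 < (m : ℝ)) (hε : 0 < ε) (hε₁ : 0 < ε₁)
    (h1 : B * μ ≤ q) (h2 : 1 ≤ μ + mK + mO) (hμ1 : μ ≤ 1) (hmK1 : mK ≤ 1) (hmO1 : mO ≤ 1)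
    (h4 : q ≤ ENNReal.ofReal (1 + θ) * Em + ENNReal.ofReal ((1 + θ⁻¹) * (C / ℓ ^ 2)) * mO)
    (hcore : (m : ℝ≥0∞) * mK ≤ Em) (hinner : mI ≤ mK)
    (hshell : mO ≤ ENNReal.ofReal Cs * mI + ENNReal.ofReal (Cs * ℓ ^ 2) * Kl) (hKl : Kl ≤ ENNReal.ofReal ε₁)
    (hθε : θ * (B.toReal + 1) * 6 ≤ ε) (hε₁a : ε₁ * (Cs + 1) * (B.toReal + 1) * a ^ 2 * 6 ≤ ε)
    (hε₁b : ε₁ * (C * Cs + 1) * (1 + θ) * 6 ≤ ε * θ)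
    (hm1 : (1 + Cs) * (B.toReal ^ 2 + 1) * 6 ≤ ε * m)
    (hm2 : (1 + θ) * C * Cs * (B.toReal + 1) * 6 ≤ ε * θ * ℓ ^ 2 * m) :
    B ≤ Em + ENNReal.ofReal ε := by
  -- finiteness
  have hEm : Em ≠ ⊤ := ne_top_of_le_ne_top hB hEmB
  have hμ : μ ≠ ⊤ := ne_top_of_le_ne_top ENNReal.one_ne_top hμ1
  have hmK : mK ≠ ⊤ := ne_top_of_le_ne_top ENNReal.one_ne_top hmK1
  have hmO : mO ≠ ⊤ := ne_top_of_le_ne_top ENNReal.one_ne_top hmO1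
  have hmI : mI ≠ ⊤ := ne_top_of_le_ne_top hmK hinner
  have hKl' : Kl ≠ ⊤ := ne_top_of_le_ne_top ENNReal.ofReal_ne_top hKl
  have h4top : ENNReal.ofReal (1 + θ) * Em + ENNReal.ofReal ((1 + θ⁻¹) * (C / ℓ ^ 2)) * mO ≠ ⊤ :=
    ENNReal.add_ne_top.2 ⟨ENNReal.mul_ne_top ENNReal.ofReal_ne_top hEm,
      ENNReal.mul_ne_top ENNReal.ofReal_ne_top hmO⟩
  have hq : q ≠ ⊤ := ne_top_of_le_ne_top h4top h4
  have hshtop : ENNReal.ofReal Cs * mI + ENNReal.ofReal (Cs * ℓ ^ 2) * Kl ≠ ⊤ :=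
    ENNReal.add_ne_top.2 ⟨ENNReal.mul_ne_top ENNReal.ofReal_ne_top hmI,
      ENNReal.mul_ne_top ENNReal.ofReal_ne_top hKl'⟩
  -- pass to reals
  have hA : 0 ≤ (1 + θ⁻¹) * (C / ℓ ^ 2) := by positivity
  have r1 : B.toReal * μ.toReal ≤ q.toReal := by
    rw [← ENNReal.toReal_mul]; exact ENNReal.toReal_mono hq h1
  have r2 : 1 ≤ μ.toReal + mK.toReal + mO.toReal := by
    have := ENNReal.toReal_mono (ENNReal.add_ne_top.2 ⟨ENNReal.add_ne_top.2 ⟨hμ, hmK⟩, hmO⟩) h2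
    rwa [ENNReal.toReal_add (ENNReal.add_ne_top.2 ⟨hμ, hmK⟩) hmO, ENNReal.toReal_add hμ hmK,
      ENNReal.toReal_one] at this
  have r4 : q.toReal ≤ (1 + θ) * Em.toReal + (1 + θ⁻¹) * (C / ℓ ^ 2) * mO.toReal := by
    have := ENNReal.toReal_mono h4top h4
    rwa [ENNReal.toReal_add (ENNReal.mul_ne_top ENNReal.ofReal_ne_top hEm)
      (ENNReal.mul_ne_top ENNReal.ofReal_ne_top hmO), ENNReal.toReal_mul, ENNReal.toReal_mul,
      ENNReal.toReal_ofReal (by positivity), ENNReal.toReal_ofReal hA] at this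
  have rcore : (m : ℝ) * mK.toReal ≤ Em.toReal := by
    have := ENNReal.toReal_mono hEm hcore
    rwa [ENNReal.toReal_mul, ENNReal.toReal_natCast] at this
  have rinner : mI.toReal ≤ mK.toReal := ENNReal.toReal_mono hmK hinner
  have rshell : mO.toReal ≤ Cs * mI.toReal + Cs * ℓ ^ 2 * Kl.toReal := by
    have := ENNReal.toReal_mono hshtop hshell
    rwa [ENNReal.toReal_add (ENNReal.mul_ne_top ENNReal.ofReal_ne_top hmI)
      (ENNReal.mul_ne_top ENNReal.ofReal_ne_top hKl'), ENNReal.toReal_mul, ENNReal.toReal_mul,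
      ENNReal.toReal_ofReal hCs, ENNReal.toReal_ofReal (by positivity)] at this
  have rKl : Kl.toReal ≤ ε₁ := ENNReal.toReal_le_of_le_ofReal hε₁.le hKl
  have rEm : Em.toReal ≤ B.toReal := ENNReal.toReal_mono hB hEmB
  have key : B.toReal ≤ Em.toReal + ε :=
    bookkeeping ENNReal.toReal_nonneg rEm hθ hCs hC hℓ hℓa hm hε₁.le r1 r2 r4 (rcore.trans rEm) rinner rshell rKl
      hθε hε₁a hε₁b hm1 hm2
  calc B = ENNReal.ofReal B.toReal := (ENNReal.ofReal_toReal hB).symm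
    _ ≤ ENNReal.ofReal (Em.toReal + ε) := ENNReal.ofReal_le_ofReal key
    _ = Em + ENNReal.ofReal ε := by
        rw [ENNReal.ofReal_add ENNReal.toReal_nonneg hε.le, ENNReal.ofReal_toReal hEm]


end AlphaPhys

/-- **Registered landing stub of this support file** (`stub_alphaPhysBookkeeping`, = `AlphaPhys.bookkeeping_ennreal` with all
binders explicit): the `ε`-bookkeeping of the cut-off argument in `ℝ≥0∞`. [folklore] -/
theorem stub_alphaPhysBookkeeping :
    ∀ (B Em q μ mK mO mI Kl : ℝ≥0∞) (θ Cs C ℓ a ε ε₁ : ℝ) (m : ℕ),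
      B ≠ ⊤ → Em ≤ B → 0 < θ → 0 ≤ Cs → 0 ≤ C → 0 < ℓ → ℓ ≤ a → 0 < (m : ℝ) → 0 < ε → 0 < ε₁ →
      B * μ ≤ q → 1 ≤ μ + mK + mO → μ ≤ 1 → mK ≤ 1 → mO ≤ 1 →
      q ≤ ENNReal.ofReal (1 + θ) * Em + ENNReal.ofReal ((1 + θ⁻¹) * (C / ℓ ^ 2)) * mO →
      (m : ℝ≥0∞) * mK ≤ Em → mI ≤ mK →
      mO ≤ ENNReal.ofReal Cs * mI + ENNReal.ofReal (Cs * ℓ ^ 2) * Kl → Kl ≤ ENNReal.ofReal ε₁ →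
      θ * (B.toReal + 1) * 6 ≤ ε → ε₁ * (Cs + 1) * (B.toReal + 1) * a ^ 2 * 6 ≤ ε →
      ε₁ * (C * Cs + 1) * (1 + θ) * 6 ≤ ε * θ →
      (1 + Cs) * (B.toReal ^ 2 + 1) * 6 ≤ ε * m →
      (1 + θ) * C * Cs * (B.toReal + 1) * 6 ≤ ε * θ * ℓ ^ 2 * m →
      B ≤ Em + ENNReal.ofReal ε :=
  fun _ _ _ _ _ _ _ _ _ _ _ _ _ _ _ _ hB hEmB hθ hCs hC hℓ hℓa hm hε hε₁ h1 h2 hμ1 hmK1 hmO1 h4 hcore hinner hshell hKl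
      hθε hε₁a hε₁b hm1 hm2 =>
    AlphaPhys.bookkeeping_ennreal hB hEmB hθ hCs hC hℓ hℓa hm hε hε₁ h1 h2 hμ1 hmK1 hmO1 h4 hcore hinner hshell hKl
      hθε hε₁a hε₁b hm1 hm2

end Summit.AtomisticToContinuum.BoseEinsteinCondensation.Cruxes.HardCoreExtension.ThirdLawCurrentFloor

end
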